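import Mathlib
import Summits.KontsevichZagierPeriods.Zeta5Search.RecordCellCAtlas
import Summits.KontsevichZagierPeriods.Zeta5Search.RecordCellDProof
import HarnessLib

/-!
# ζ(5) search — RECORD CELL C is a THEOREM: `v_p(Cas₇(b(n))) ≥ −12` for `8.5n < p < 9n` on the Brown–Zudilin record ray

Cell `pub-zeta5` (HONEST FRAMING: systematic search; no irrationality claim unless certified), P1 prover seat
generation 6.  Census g11's cell C of the record ray `b(n) = n·(41;17,…,11)` (`STRUCTURE §15.4`: θ = p/n ∈ (17/2, 9), weight 0.500
nats/step, `v_p(Cas₇) = −12` at 13/13 instances, proved `−13`; not among the three cells typed in `CellAtlas`, so the statement is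
spelled out here in the same shape): **for `n ≥ 2` and every prime `17n < 2p < 18n`, `v_p(Cas₇(b(n))) ≥ −12`** (`recordCellC`).  gen-2 g9's
atlas (REPORT §10): an LB♯♯ cell with `m = −8` and four-point types; the proof is the cell-D assembly (`RecordCellDProof`) verbatim on the
atlas `RecordCellCAtlas` with the generic digit layer `digits_of_level` (`L = 3`): pairs `x`, `x̄ = 41n − (x+3p)`; `p⁵W_M ≡ −α_C G`,
`p⁸V_M ≡ β_C G (mod p)` for `b` and `b+e₇` with the symbolic constants `α_C = ŵ(1,−4,−6,1) − ŵ(1,−6,−4,1)`, `β_C` likewise (numerically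
`66`, `−98` — gen-2's digit vectors —, values never used); the palindromic `(1,−5,−5,1)` pairs cancel; `A′B − AB′ ≡ 0`;
`p¹³Cas₇ = (A′B−AB′) + p(…) + p²(…)`.  Valuations of rationals; nothing about irrationality.  Exact cross-check: `code/p1/g6/cellE_check.py`.
-/

noncomputable section

open Finset

namespace Summit.KontsevichZagierPeriods.Zeta5Search.CellC

open Summit.KontsevichZagierPeriods.Zeta5Search.DualSeries (InBox)
open Summit.KontsevichZagierPeriods.Zeta5Search.WedgeDictionary (pfData coeffW coeffV)
open Summit.KontsevichZagierPeriods.Zeta5Search.CasoratianValuation (InPolytope shift casoratian)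
open Summit.KontsevichZagierPeriods.Zeta5Search.ClusterValuation
open Summit.KontsevichZagierPeriods.Zeta5Search.PadicSeries
open Summit.KontsevichZagierPeriods.Zeta5Search.BigPrime (shift_zero padicNorm_mul_le_one)
open Summit.KontsevichZagierPeriods.Zeta5Search.CellA
open Summit.KontsevichZagierPeriods.Zeta5Search.LevelClass
open Summit.KontsevichZagierPeriods.Zeta5Search.CellD (digits_of_level padicNorm_classW_le padicNorm_classV_le_of nI_scale
  small_of_two_mul)

variable {p : ℕ} [hp : Fact p.Prime]

/-! ### §1 The three four-point types and their constants -/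

/-- Type `(1,−4,−6,1)`. -/
def eC1 : ℕ → ℤ
  | 0 => 1 | 1 => -4 | 2 => -6 | 3 => 1 | _ => 0
/-- Type `(1,−6,−4,1)` (reverse of `eC1`). -/
def eC2 : ℕ → ℤ
  | 0 => 1 | 1 => -6 | 2 => -4 | 3 => 1 | _ => 0
/-- The palindromic type `(1,−5,−5,1)`. -/
def eCS : ℕ → ℤ
  | 0 => 1 | 1 => -5 | 2 => -5 | 3 => 1 | _ => 0

/-- `α_C = ŵ(1,−4,−6,1) − ŵ(1,−6,−4,1)` (symbolic). -/
def alphaC : ℚ := typeW 3 eC1 - typeW 3 eC2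
/-- `β_C = v̂(1,−4,−6,1) − v̂(1,−6,−4,1)` (symbolic). -/
def betaC : ℚ := typeV 3 eC1 - typeV 3 eC2

/-- `E = −8` for the three types. -/
theorem typeExp_eC : typeExp 3 eC1 = -8 ∧ typeExp 3 eC2 = -8 ∧ typeExp 3 eCS = -8 := by decide

omit hp in
/-- Four point values as a level exponent vector. -/
theorem he_of_four {b : ℕ → ℤ} {x : ℕ} {e : ℕ → ℤ} (h0 : netExp b x = e 0) (h1 : netExp b (x + p) = e 1)
    (h2 : netExp b (x + 2 * p) = e 2) (h3 : netExp b (x + 3 * p) = e 3) : ∀ k ≤ 3, netExp b (x + k * p) = e k := by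
  intro k hk
  interval_cases k
  · simpa using h0
  · simpa using h1
  · exact h2
  · exact h3
/-! ### §2 The two halves of `W` and `V`, the unit sum -/

/-- The minimal part of `W` (cell C). -/
def WMC (n p : ℕ) (b : ℕ → ℤ) : ℚ := ∑ x ∈ CMinAll n p, classW b p x
/-- The rest of `W` (cell C). -/
def WRC (n p : ℕ) (b : ℕ → ℤ) : ℚ := ∑ x ∈ range p \ CMinAll n p, classW b p x
/-- The minimal part of `V` (cell C). -/
def VMC (n p : ℕ) (b : ℕ → ℤ) : ℚ := ∑ x ∈ CMinAll n p, classV b p x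
/-- The rest of `V` (cell C). -/
def VRC (n p : ℕ) (b : ℕ → ℤ) : ℚ := ∑ x ∈ range p \ CMinAll n p, classV b p x
/-- The unit sum `G = Σ_{x ∈ CMinT1} ĝ_x` (cell C). -/
def GSC (n p : ℕ) (b : ℕ → ℤ) : ℚ := ∑ x ∈ CMinT1 n p, gHat b p x
omit hp in
/-- `W = W_M + W_R`. -/
theorem coeffW_splitC (n : ℕ) {p : ℕ} (hp0 : 0 < p) (b : ℕ → ℤ) : coeffW b = WMC n p b + WRC n p b := by
  rw [coeffW_eq_sum_classW b hp0, WMC, WRC, ← sum_union disjoint_sdiff, union_sdiff_of_subset (cminAll_subset n p)]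
omit hp in
/-- `V = V_M + V_R`. -/
theorem coeffV_splitC (n : ℕ) {p : ℕ} (hp0 : 0 < p) (b : ℕ → ℤ) : coeffV b = VMC n p b + VRC n p b := by
  rw [coeffV_eq_sum_classV b hp0, VMC, VRC, ← sum_union disjoint_sdiff, union_sdiff_of_subset (cminAll_subset n p)]

/-! ### §3 The minimal block for any `b′` with the cell-C class data (`b′ = b(n)` or `b(n) + e₇`) -/

section MinBlock

variable {n : ℕ} (hp17 : 17 * n < 2 * p) (hp18 : 2 * p < 18 * n) (hp5 : 5 ≤ p)
  (b : ℕ → ℤ) (hb : InPolytope b) (hwin : (b 0 + 2 : ℤ) < (p : ℤ) ^ 2) (hN : (b 0).toNat = 41 * n)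
  (hcen : ∀ x, x < p → 2 * x + 3 * p ≠ 41 * n → 2 * x + 4 * p ≠ 41 * n → ¬ CentreIn b p x)
  (hT1 : ∀ x ∈ CMinT1 n p, netExp b x = 1 ∧ netExp b (x + p) = -4 ∧ netExp b (x + 2 * p) = -6 ∧ netExp b (x + 3 * p) = 1)
  (hS : ∀ x ∈ CMinS n p, netExp b x = 1 ∧ netExp b (x + p) = -5 ∧ netExp b (x + 2 * p) = -5 ∧ netExp b (x + 3 * p) = 1)
  (hT2 : ∀ x ∈ CMinT2 n p, netExp b x = 1 ∧ netExp b (x + p) = -6 ∧ netExp b (x + 2 * p) = -4 ∧ netExp b (x + 3 * p) = 1)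

include hp17 hp18 hp5 hb hwin hN hcen hT1 hT2 in
/-- **The digit package of a `CMinT1`/`CMinT2` pair** `x`, `x̄ = 41n − (x+3p)`. -/
theorem packC1 {x : ℕ} (hx : x ∈ CMinT1 n p) :
    padicNorm p ((p : ℚ) ^ 5 * (classW b p x + classW b p (41 * n - (x + 3 * p))) + alphaC * gHat b p x) ≤
      (p : ℚ) ^ (-(1 : ℤ)) ∧
    padicNorm p ((p : ℚ) ^ 8 * (classV b p x + classV b p (41 * n - (x + 3 * p))) - betaC * gHat b p x) ≤
      (p : ℚ) ^ (-(1 : ℤ)) ∧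
    padicNorm p ((p : ℚ) ^ 5 * classW b p x) ≤ 1 ∧ padicNorm p ((p : ℚ) ^ 8 * classV b p x) ≤ 1 ∧
    padicNorm p ((p : ℚ) ^ 5 * classW b p (41 * n - (x + 3 * p))) ≤ 1 ∧
    padicNorm p ((p : ℚ) ^ 8 * classV b p (41 * n - (x + 3 * p))) ≤ 1 ∧
    padicNorm p alphaC ≤ 1 ∧ padicNorm p (gHat b p x) ≤ 1 := by
  have hx' := conj_mem_cminT2 hx
  obtain ⟨e0, e1, e2, e3⟩ := hT1 x hx
  obtain ⟨f0, f1, f2, f3⟩ := hT2 _ hx'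
  rw [mem_cminT1] at hx
  obtain ⟨hxp, h15, h24, h41⟩ := hx
  set g := gHat b p x with hgdef
  have hg0 : padicNorm p (gHat b p x - g) ≤ (p : ℚ) ^ (-(1 : ℤ)) := by
    rw [hgdef, sub_self, padicNorm.zero]; exact zpow_p_nonneg _
  obtain ⟨w1, v1, iw1, iv1, ig, hconj⟩ := digits_of_level hp5 b hb hwin hN hxp (L := 3) (by omega) (by omega)
    (hcen x hxp (by omega) (by omega)) typeExp_eC.1 (i₀ := 1) (by norm_num) (by decide) (he_of_four e0 e1 e2 e3) hg0
  have hg1 : padicNorm p (gHat b p (41 * n - (x + 3 * p)) - (-g)) ≤ (p : ℚ) ^ (-(1 : ℤ)) := by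
    rw [sub_neg_eq_add]; exact hconj
  obtain ⟨w2, v2, iw2, iv2, -, -⟩ := digits_of_level hp5 b hb hwin hN (x := 41 * n - (x + 3 * p)) (L := 3) (by omega)
    (by omega) (by omega) (hcen _ (by omega) (by omega) (by omega)) typeExp_eC.2.1 (i₀ := 1) (by norm_num) (by decide)
    (he_of_four f0 f1 f2 f3) hg1
  refine ⟨?_, ?_, ?_, ?_, ?_, ?_, nI_sub iw1 iw2, ig⟩
  · have e : (p : ℚ) ^ 5 * (classW b p x + classW b p (41 * n - (x + 3 * p))) + alphaC * gHat b p x =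
        ((p : ℚ) ^ 5 * classW b p x + g * typeW 3 eC1) +
          ((p : ℚ) ^ 5 * classW b p (41 * n - (x + 3 * p)) + (-g) * typeW 3 eC2) := by rw [alphaC]; ring
    rw [e]; exact small_add w1 w2
  · have e : (p : ℚ) ^ 8 * (classV b p x + classV b p (41 * n - (x + 3 * p))) - betaC * gHat b p x =
        ((p : ℚ) ^ 8 * classV b p x - g * typeV 3 eC1) +
          ((p : ℚ) ^ 8 * classV b p (41 * n - (x + 3 * p)) - (-g) * typeV 3 eC2) := by rw [betaC]; ring
    rw [e]; exact small_add v1 v2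
  · have e : (p : ℚ) ^ 5 * classW b p x = ((p : ℚ) ^ 5 * classW b p x + g * typeW 3 eC1) - g * typeW 3 eC1 := by ring
    rw [e]; exact nI_sub (nI_of_small w1) (padicNorm_mul_le_one ig iw1)
  · have e : (p : ℚ) ^ 8 * classV b p x = ((p : ℚ) ^ 8 * classV b p x - g * typeV 3 eC1) + g * typeV 3 eC1 := by ring
    rw [e]; exact nI_add (nI_of_small v1) (padicNorm_mul_le_one ig iv1)
  · have e : (p : ℚ) ^ 5 * classW b p (41 * n - (x + 3 * p)) =
        ((p : ℚ) ^ 5 * classW b p (41 * n - (x + 3 * p)) + (-g) * typeW 3 eC2) + g * typeW 3 eC2 := by ring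
    rw [e]; exact nI_add (nI_of_small w2) (padicNorm_mul_le_one ig iw2)
  · have e : (p : ℚ) ^ 8 * classV b p (41 * n - (x + 3 * p)) =
        ((p : ℚ) ^ 8 * classV b p (41 * n - (x + 3 * p)) - (-g) * typeV 3 eC2) - g * typeV 3 eC2 := by ring
    rw [e]; exact nI_sub (nI_of_small v2) (padicNorm_mul_le_one ig iv2)

include hp17 hp18 hp5 hb hwin hN hcen hS in
/-- **The digit package of a `CMinS` pair** `x`, `x̄ = 41n − (x+3p)`: the pair sums vanish modulo `p`; integrality. -/
theorem packCS {x : ℕ} (hx : x ∈ CMinS n p) :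
    padicNorm p ((p : ℚ) ^ 5 * (classW b p x + classW b p (41 * n - (x + 3 * p)))) ≤ (p : ℚ) ^ (-(1 : ℤ)) ∧
    padicNorm p ((p : ℚ) ^ 8 * (classV b p x + classV b p (41 * n - (x + 3 * p)))) ≤ (p : ℚ) ^ (-(1 : ℤ)) ∧
    padicNorm p ((p : ℚ) ^ 5 * classW b p x) ≤ 1 ∧ padicNorm p ((p : ℚ) ^ 8 * classV b p x) ≤ 1 := by
  have hx' := conj_mem_cminS hp17 hx
  obtain ⟨e0, e1, e2, e3⟩ := hS x hx
  obtain ⟨f0, f1, f2, f3⟩ := hS _ hx'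
  rw [mem_cminS] at hx hx'
  obtain ⟨hxp, h16, h25, hself⟩ := hx
  set g := gHat b p x with hgdef
  have hg0 : padicNorm p (gHat b p x - g) ≤ (p : ℚ) ^ (-(1 : ℤ)) := by
    rw [hgdef, sub_self, padicNorm.zero]; exact zpow_p_nonneg _
  obtain ⟨w1, v1, iw1, iv1, ig, hconj⟩ := digits_of_level hp5 b hb hwin hN hxp (L := 3) (by omega) (by omega)
    (hcen x hxp hself (by omega)) typeExp_eC.2.2 (i₀ := 1) (by norm_num) (by decide) (he_of_four e0 e1 e2 e3) hg0
  have hg1 : padicNorm p (gHat b p (41 * n - (x + 3 * p)) - (-g)) ≤ (p : ℚ) ^ (-(1 : ℤ)) := by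
    rw [sub_neg_eq_add]; exact hconj
  obtain ⟨w2, v2, -, -, -, -⟩ := digits_of_level hp5 b hb hwin hN (x := 41 * n - (x + 3 * p)) (L := 3) (by omega)
    (by omega) (by omega) (hcen _ (by omega) hx'.2.2.2 (by omega)) typeExp_eC.2.2 (i₀ := 1) (by norm_num) (by decide)
    (he_of_four f0 f1 f2 f3) hg1
  refine ⟨?_, ?_, ?_, ?_⟩
  · have e : (p : ℚ) ^ 5 * (classW b p x + classW b p (41 * n - (x + 3 * p))) =
        ((p : ℚ) ^ 5 * classW b p x + g * typeW 3 eCS) +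
          ((p : ℚ) ^ 5 * classW b p (41 * n - (x + 3 * p)) + (-g) * typeW 3 eCS) := by ring
    rw [e]; exact small_add w1 w2
  · have e : (p : ℚ) ^ 8 * (classV b p x + classV b p (41 * n - (x + 3 * p))) =
        ((p : ℚ) ^ 8 * classV b p x - g * typeV 3 eCS) +
          ((p : ℚ) ^ 8 * classV b p (41 * n - (x + 3 * p)) - (-g) * typeV 3 eCS) := by ring
    rw [e]; exact small_add v1 v2
  · have e : (p : ℚ) ^ 5 * classW b p x = ((p : ℚ) ^ 5 * classW b p x + g * typeW 3 eCS) - g * typeW 3 eCS := by ring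
    rw [e]; exact nI_sub (nI_of_small w1) (padicNorm_mul_le_one ig iw1)
  · have e : (p : ℚ) ^ 8 * classV b p x = ((p : ℚ) ^ 8 * classV b p x - g * typeV 3 eCS) + g * typeV 3 eCS := by ring
    rw [e]; exact nI_add (nI_of_small v1) (padicNorm_mul_le_one ig iv1)

include hp18 in
omit hp in
/-- A sum over `CMinT2` is the sum over `CMinT1` of the conjugates. -/
theorem sum_cminT2_eq (f : ℕ → ℚ) : ∑ x ∈ CMinT2 n p, f x = ∑ x ∈ CMinT1 n p, f (41 * n - (x + 3 * p)) := by
  refine (sum_nbij' (fun x => 41 * n - (x + 3 * p)) (fun x => 41 * n - (x + 3 * p)) (fun x hx => conj_mem_cminT2 hx)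
    (fun x hx => conj_mem_cminT1 hp18 hx) (fun x hx => ?_) (fun x hx => ?_) (fun x hx => rfl)).symm
  · have := mem_cminT1.1 hx; omega
  · have := mem_cminT2.1 hx; omega

include hp17 in
omit hp in
/-- A sum over `CMinS` equals the sum of the conjugates. -/
theorem sum_cminS_conj (f : ℕ → ℚ) : ∑ x ∈ CMinS n p, f (41 * n - (x + 3 * p)) = ∑ x ∈ CMinS n p, f x :=
  sum_nbij' (fun x => 41 * n - (x + 3 * p)) (fun x => 41 * n - (x + 3 * p)) (fun x hx => conj_mem_cminS hp17 hx)
    (fun x hx => conj_mem_cminS hp17 hx) (fun x hx => by have := mem_cminS.1 hx; omega)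
    (fun x hx => by have := mem_cminS.1 hx; omega) (fun x hx => rfl)

include hp18 in
omit hp in
/-- Splitting a sum over `CMinAll` into conjugate pairs of `CMinT1 ∪ CMinT2` and the classes of `CMinS`. -/
theorem sum_cminAll (f : ℕ → ℚ) :
    ∑ x ∈ CMinAll n p, f x = ∑ x ∈ CMinT1 n p, (f x + f (41 * n - (x + 3 * p))) + ∑ x ∈ CMinS n p, f x := by
  rw [CMinAll, sum_union (disjoint_cminT1S_cminT2 n p), sum_union (disjoint_cminT1_cminS n p), sum_cminT2_eq hp18,
    sum_add_distrib]
  ring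

include hp17 hp18 hp5 hb hwin hN hcen hT1 hS hT2 in
/-- **The minimal block (cell C)**: integrality and THE TWO CONGRUENCES `p⁵W_M + α_C G ≡ 0`, `p⁸V_M − β_C G ≡ 0 (mod p)`. -/
theorem minBlockC :
    padicNorm p ((p : ℚ) ^ 5 * WMC n p b) ≤ 1 ∧ padicNorm p ((p : ℚ) ^ 8 * VMC n p b) ≤ 1 ∧
    padicNorm p (alphaC * GSC n p b) ≤ 1 ∧ padicNorm p (GSC n p b) ≤ 1 ∧
    padicNorm p ((p : ℚ) ^ 5 * WMC n p b + alphaC * GSC n p b) ≤ (p : ℚ) ^ (-(1 : ℤ)) ∧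
    padicNorm p ((p : ℚ) ^ 8 * VMC n p b - betaC * GSC n p b) ≤ (p : ℚ) ^ (-(1 : ℤ)) := by
  have PT := fun x (hx : x ∈ CMinT1 n p) => packC1 hp17 hp18 hp5 b hb hwin hN hcen hT1 hT2 hx
  have PS := fun x (hx : x ∈ CMinS n p) => packCS hp17 hp18 hp5 b hb hwin hN hcen hS hx
  refine ⟨?_, ?_, ?_, ?_, ?_, ?_⟩
  · rw [WMC, mul_sum, sum_cminAll hp18]
    refine nI_add (padicNorm.sum_le' (fun x hx => ?_) zero_le_one) (padicNorm.sum_le' (fun x hx => ?_) zero_le_one)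
    · obtain ⟨-, -, h1, -, h3, -, -, -⟩ := PT x hx
      exact nI_add h1 h3
    · exact (PS x hx).2.2.1
  · rw [VMC, mul_sum, sum_cminAll hp18]
    refine nI_add (padicNorm.sum_le' (fun x hx => ?_) zero_le_one) (padicNorm.sum_le' (fun x hx => ?_) zero_le_one)
    · obtain ⟨-, -, -, h2, -, h4, -, -⟩ := PT x hx
      exact nI_add h2 h4
    · exact (PS x hx).2.2.2
  · rw [GSC, mul_sum]
    exact padicNorm.sum_le' (fun x hx => padicNorm_mul_le_one (PT x hx).2.2.2.2.2.2.1 (PT x hx).2.2.2.2.2.2.2) zero_le_one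
  · rw [GSC]
    exact padicNorm.sum_le' (fun x hx => (PT x hx).2.2.2.2.2.2.2) zero_le_one
  · have e : (p : ℚ) ^ 5 * WMC n p b + alphaC * GSC n p b =
        ∑ x ∈ CMinT1 n p, ((p : ℚ) ^ 5 * (classW b p x + classW b p (41 * n - (x + 3 * p))) + alphaC * gHat b p x) +
          ∑ x ∈ CMinS n p, (p : ℚ) ^ 5 * classW b p x := by
      have h1 : ∑ x ∈ CMinT1 n p, ((p : ℚ) ^ 5 * (classW b p x + classW b p (41 * n - (x + 3 * p))) +
            alphaC * gHat b p x) =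
          ∑ x ∈ CMinT1 n p, ((p : ℚ) ^ 5 * classW b p x + (p : ℚ) ^ 5 * classW b p (41 * n - (x + 3 * p))) +
            ∑ x ∈ CMinT1 n p, alphaC * gHat b p x := by
        rw [← sum_add_distrib]; exact sum_congr rfl (fun x _ => by ring)
      rw [WMC, mul_sum, sum_cminAll hp18, GSC, mul_sum, h1]; ring
    rw [e]
    refine small_add (padicNorm.sum_le' (fun x hx => (PT x hx).1) (zpow_p_nonneg _)) (small_of_two_mul hp5 ?_)
    have e2 : (2 : ℚ) * ∑ x ∈ CMinS n p, (p : ℚ) ^ 5 * classW b p x =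
        ∑ x ∈ CMinS n p, (p : ℚ) ^ 5 * (classW b p x + classW b p (41 * n - (x + 3 * p))) := by
      rw [two_mul, sum_congr rfl fun x _ => mul_add _ _ _, sum_add_distrib,
        sum_cminS_conj hp17 (fun x => (p : ℚ) ^ 5 * classW b p x)]
    rw [e2]
    exact padicNorm.sum_le' (fun x hx => (PS x hx).1) (zpow_p_nonneg _)
  · have e : (p : ℚ) ^ 8 * VMC n p b - betaC * GSC n p b =
        ∑ x ∈ CMinT1 n p, ((p : ℚ) ^ 8 * (classV b p x + classV b p (41 * n - (x + 3 * p))) - betaC * gHat b p x) +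
          ∑ x ∈ CMinS n p, (p : ℚ) ^ 8 * classV b p x := by
      have h1 : ∑ x ∈ CMinT1 n p, ((p : ℚ) ^ 8 * (classV b p x + classV b p (41 * n - (x + 3 * p))) -
            betaC * gHat b p x) =
          ∑ x ∈ CMinT1 n p, ((p : ℚ) ^ 8 * classV b p x + (p : ℚ) ^ 8 * classV b p (41 * n - (x + 3 * p))) -
            ∑ x ∈ CMinT1 n p, betaC * gHat b p x := by
        rw [← sum_sub_distrib]; exact sum_congr rfl (fun x _ => by ring)
      rw [VMC, mul_sum, sum_cminAll hp18, GSC, mul_sum, h1]; ring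
    rw [e]
    refine small_add (padicNorm.sum_le' (fun x hx => (PT x hx).2.1) (zpow_p_nonneg _)) (small_of_two_mul hp5 ?_)
    have e2 : (2 : ℚ) * ∑ x ∈ CMinS n p, (p : ℚ) ^ 8 * classV b p x =
        ∑ x ∈ CMinS n p, (p : ℚ) ^ 8 * (classV b p x + classV b p (41 * n - (x + 3 * p))) := by
      rw [two_mul, sum_congr rfl fun x _ => mul_add _ _ _, sum_add_distrib,
        sum_cminS_conj hp17 (fun x => (p : ℚ) ^ 8 * classV b p x)]
    rw [e2]
    exact padicNorm.sum_le' (fun x hx => (PS x hx).2.1) (zpow_p_nonneg _)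

end MinBlock
/-! ### §4 The rest and RECORD CELL C -/

section Rest

variable {n : ℕ} (hn : 1 ≤ n) (hp17 : 17 * n < 2 * p) (hp18 : 2 * p < 18 * n) (hp5 : 5 ≤ p)

include hp17 hp18 hp5 in
/-- The class data of `b(n)` on the non-minimal classes: `E_x ≥ −7`, `ν_x ≥ −7`. -/
theorem rest_dataC {x : ℕ} (hx : x ∈ range p \ CMinAll n p) :
    x < p ∧ (1 ≤ classPoleCount (bRec n) p x → -7 ≤ classNu (bRec n) p x) ∧
      (2 ≤ classPoleCount (bRec n) p x → -7 ≤ classExp (bRec n) p x) := by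
  rw [mem_sdiff, mem_range, CMinAll, mem_union, mem_union, not_or, not_or] at hx
  obtain ⟨hxp, ⟨h1, h2⟩, h3⟩ := hx
  have hodd : ¬ 2 ∣ p := fun h => by
    have := (Nat.prime_dvd_prime_iff_eq Nat.prime_two hp.out).1 h; omega
  have hE := classExpC_ge_of_notMin hp17 hp18 hxp hodd h1 h2 h3
  exact ⟨hxp, fun _ => hE.trans (classExp_le_classNu _ _ _), fun _ => hE⟩

include hn hp17 hp18 hp5 in
/-- **`‖W_R‖ ≤ p⁴` and `‖V_R‖ ≤ p⁷`** for `b(n)` and for `b(n) + e₇`. -/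
theorem rest_C : (padicNorm p (WRC n p (bRec n)) ≤ (p : ℚ) ^ (4 : ℤ) ∧ padicNorm p (VRC n p (bRec n)) ≤ (p : ℚ) ^ (7 : ℤ)) ∧
    (padicNorm p (WRC n p (shift (bRec n) 7)) ≤ (p : ℚ) ^ (4 : ℤ) ∧
      padicNorm p (VRC n p (shift (bRec n) 7)) ≤ (p : ℚ) ^ (7 : ℤ)) := by
  have hb := inPolytope_bRec n
  have hb' := inPolytope_shift_bRec n 7 hn (by norm_num) (by norm_num)
  have hwin : (bRec n 0 + 2 : ℤ) < (p : ℤ) ^ 2 := by rw [bRec_zero]; nlinarith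
  have hwin' : (shift (bRec n) 7 0 + 2 : ℤ) < (p : ℤ) ^ 2 := by rw [shift_zero _ (by norm_num)]; exact hwin
  have hcnt : ∀ x, classPoleCount (shift (bRec n) 7) p x ≤ classPoleCount (bRec n) p x :=
    fun x => classPoleCount_shift_le _ hb.1 (by norm_num) p x
  refine ⟨⟨padicNorm.sum_le' (fun x hx => ?_) (zpow_p_nonneg _), padicNorm.sum_le' (fun x hx => ?_) (zpow_p_nonneg _)⟩,
    ⟨padicNorm.sum_le' (fun x hx => ?_) (zpow_p_nonneg _), padicNorm.sum_le' (fun x hx => ?_) (zpow_p_nonneg _)⟩⟩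
  · obtain ⟨-, -, hE⟩ := rest_dataC hp17 hp18 hp5 hx
    have := padicNorm_classW_le (m := -7) _ hb hp5 hwin (by norm_num) hE
    norm_num at this; exact this
  · obtain ⟨hxp, hν, -⟩ := rest_dataC hp17 hp18 hp5 hx
    have := padicNorm_classV_le_of (v := -7) _ hb hp5 hwin hxp hν
    norm_num at this; exact this
  · obtain ⟨-, -, hE⟩ := rest_dataC hp17 hp18 hp5 hx
    have := padicNorm_classW_le (m := -7) _ hb' hp5 hwin' (by norm_num) fun h2 =>
      (hE (h2.trans (hcnt x))).trans (classExp_shift_ge _ hb.1 (by norm_num) p x)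
    norm_num at this; exact this
  · obtain ⟨hxp, hν, -⟩ := rest_dataC hp17 hp18 hp5 hx
    have := padicNorm_classV_le_of (v := -7) _ hb' hp5 hwin' hxp fun h1 =>
      (hν (h1.trans (hcnt x))).trans (classNu_shift_ge _ hb.1 (by norm_num) h1)
    norm_num at this; exact this

end Rest

/-- **RECORD CELL C (census g11 `STRUCTURE §15.4`, weight 0.500) is a THEOREM.**  For `n ≥ 2` and every prime `8.5n < p < 9n`:
`v_p(W(b⁺)V(b) − W(b)V(b⁺)) ≥ −12` for `b = b(n) = n·(41;17,…,11)`, `b⁺ = b + e₇` (THEOREM LB: `−13`; census: `−12` at 13/13). -/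
theorem recordCellC : ∀ n p : ℕ, 2 ≤ n → p.Prime → 17 * n < 2 * p → 2 * p < 18 * n → casoratian (bRec n) 7 ≠ 0 →
    (-12 : ℤ) ≤ padicValRat p (casoratian (bRec n) 7) := by
  intro n p hn2 hprime hp17 hp18 hne
  haveI : Fact p.Prime := ⟨hprime⟩
  have hn : 1 ≤ n := by omega
  have hp5 : 5 ≤ p := by omega
  set b := bRec n with hbdef
  set b' := shift (bRec n) 7 with hb'def
  have hb : InPolytope b := inPolytope_bRec n
  have hb' : InPolytope b' := inPolytope_shift_bRec n 7 hn (by norm_num) (by norm_num)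
  have hwin : (b 0 + 2 : ℤ) < (p : ℤ) ^ 2 := by rw [hbdef, bRec_zero]; nlinarith
  have hwin' : (b' 0 + 2 : ℤ) < (p : ℤ) ^ 2 := by rw [hb'def, shift_zero _ (by norm_num)]; exact hwin
  have hN : (b 0).toNat = 41 * n := bRec_zero_toNat n
  have hN' : (b' 0).toNat = 41 * n := shift7_zero_toNat n
  have hcen : ∀ x, x < p → 2 * x + 3 * p ≠ 41 * n → 2 * x + 4 * p ≠ 41 * n → ¬ CentreIn b p x :=
    fun x hx h3 h4 => not_centreInC hp17 hp18 hx h3 h4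
  have hcen' : ∀ x, x < p → 2 * x + 3 * p ≠ 41 * n → 2 * x + 4 * p ≠ 41 * n → ¬ CentreIn b' p x :=
    fun x hx h3 h4 h => not_centreInC hp17 hp18 hx h3 h4 ((centreIn_shift (bRec n) (by norm_num : 1 ≤ 7) p x).1 h)
  have hT1 := fun x (hx : x ∈ CMinT1 n p) => (netExp_cminT1 hp17 hp18 hx).1
  have hS := fun x (hx : x ∈ CMinS n p) => (netExp_cminS hp17 hp18 hx).1
  have hT2 := fun x (hx : x ∈ CMinT2 n p) => (netExp_cminT2 hp17 hp18 hx).1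
  have hT1' := fun x (hx : x ∈ CMinT1 n p) => (netExp_cminT1 hp17 hp18 hx).2.1
  have hS' := fun x (hx : x ∈ CMinS n p) => (netExp_cminS hp17 hp18 hx).2.1
  have hT2' := fun x (hx : x ∈ CMinT2 n p) => (netExp_cminT2 hp17 hp18 hx).2.1
  set A := (p : ℚ) ^ 5 * WMC n p b with hAdef
  set A' := (p : ℚ) ^ 5 * WMC n p b' with hA'def
  set B := (p : ℚ) ^ 8 * VMC n p b with hBdef
  set B' := (p : ℚ) ^ 8 * VMC n p b' with hB'def
  set G := GSC n p b with hGdef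
  set G' := GSC n p b' with hG'def
  set C := (p : ℚ) ^ 7 * VRC n p b with hCdef
  set C' := (p : ℚ) ^ 7 * VRC n p b' with hC'def
  set R := (p : ℚ) ^ 4 * WRC n p b with hRdef
  set R' := (p : ℚ) ^ 4 * WRC n p b' with hR'def
  obtain ⟨iA, iB, iαG, iG, cA, cB⟩ := minBlockC hp17 hp18 hp5 b hb hwin hN hcen hT1 hS hT2
  obtain ⟨iA', iB', iαG', iG', cA', cB'⟩ := minBlockC hp17 hp18 hp5 b' hb' hwin' hN' hcen' hT1' hS' hT2'
  obtain ⟨⟨iWR, iVR⟩, ⟨iWR', iVR'⟩⟩ := rest_C (p := p) hn hp17 hp18 hp5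
  have iR : padicNorm p R ≤ 1 := nI_scale iWR
  have iR' : padicNorm p R' ≤ 1 := nI_scale iWR'
  have iC : padicNorm p C ≤ 1 := nI_scale iVR
  have iC' : padicNorm p C' ≤ 1 := nI_scale iVR'
  have key : padicNorm p (A' * B - A * B') ≤ (p : ℚ) ^ (-(1 : ℤ)) := by
    have e : A' * B - A * B' =
        (A' + alphaC * G') * B - alphaC * G' * (B - betaC * G) - (A + alphaC * G) * B' + alphaC * G * (B' - betaC * G') := by
      ring
    rw [e]
    exact small_add (small_sub (small_sub (by rw [mul_comm]; exact small_mul iB cA') (small_mul iαG' cB))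
      (by rw [mul_comm]; exact small_mul iB' cA)) (small_mul iαG cB')
  have hp0 : (p : ℚ) ≠ 0 := Nat.cast_ne_zero.2 hprime.ne_zero
  have hW : coeffW b = A / (p : ℚ) ^ 5 + R / (p : ℚ) ^ 4 := by
    rw [coeffW_splitC n hprime.pos b, hAdef, hRdef]; field_simp
  have hW' : coeffW b' = A' / (p : ℚ) ^ 5 + R' / (p : ℚ) ^ 4 := by
    rw [coeffW_splitC n hprime.pos b', hA'def, hR'def]; field_simp
  have hV : coeffV b = B / (p : ℚ) ^ 8 + C / (p : ℚ) ^ 7 := by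
    rw [coeffV_splitC n hprime.pos b, hBdef, hCdef]; field_simp
  have hV' : coeffV b' = B' / (p : ℚ) ^ 8 + C' / (p : ℚ) ^ 7 := by
    rw [coeffV_splitC n hprime.pos b', hB'def, hC'def]; field_simp
  have e : (p : ℚ) ^ 13 * casoratian b 7 =
      (A' * B - A * B') + p * (A' * C + R' * B - A * C' - R * B') + (p : ℚ) ^ 2 * (R' * C - R * C') := by
    rw [casoratian, ← hb'def, hW, hW', hV, hV']
    field_simp
    ring
  have ip : padicNorm p (p : ℚ) ≤ 1 := nI_nat p
  have h13 : padicNorm p ((p : ℚ) ^ 13 * casoratian b 7) ≤ (p : ℚ) ^ (-(1 : ℤ)) := by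
    rw [e]
    refine small_add (small_add key (small_p_mul ?_)) ?_
    · exact nI_sub (nI_sub (nI_add (padicNorm_mul_le_one iA' iC) (padicNorm_mul_le_one iR' iB))
        (padicNorm_mul_le_one iA iC')) (padicNorm_mul_le_one iR iB')
    · rw [pow_two, mul_assoc]
      exact small_mul ip (small_p_mul (nI_sub (padicNorm_mul_le_one iR' iC) (padicNorm_mul_le_one iR iC')))
  apply val_ge_of_padicNorm_le hne
  have hp13n : padicNorm p ((p : ℚ) ^ 13) = ((p : ℚ) ^ 13)⁻¹ := padicNorm_p_pow 13
  have hpos : (0 : ℚ) < (p : ℚ) ^ 13 := pow_pos (by exact_mod_cast hprime.pos) 13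
  rw [padicNorm.mul, hp13n, inv_mul_le_iff₀ hpos] at h13
  refine h13.trans (le_of_eq ?_)
  rw [neg_neg, ← zpow_natCast, ← zpow_add₀ hp0]
  norm_num

end Summit.KontsevichZagierPeriods.Zeta5Search.CellC

end
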